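import Summits.HodgeConjecture.HodgeConjecture.Theses.AnchorTransport
import Literature.AlgebraicGeometry.Motives.SmoothProperWittModel
import Literature.AlgebraicGeometry.Crystalline.BlochEsnaultKerzLifting

/-!
# Route AnchorTransport — crux `VariationalHodge` (stmt-HodgeConjecture-1076), line `padic-disc-transport`:
# the MODEL-SUPPLY half of STUB S (`ArithmeticDiscSupply`)

HONEST FRAMING: research route conditional on HC_CM; not a corollary; Q11.4-sentence-2 already refuted in dim ≥ 3.
Helper file on the crux item (nothing here closes it; no definition, no named fact, no `sorry`;
`HC_CM` does not occur). Cell `pub-hodge-ring2`, binder seat `ring2-b03` (gen 33), BINDER-OWNERS row b03.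

STUB S of the registered skeleton `Cruxes/VariationalHodge/Lines/padic_disc_transport.lean` asks, for
descended crux data `f₀ : 𝒳₀ ⟶ S₀` over a countable field `k ↪ ℂ` and any bound `N`, for: a prime
`q ≥ N`, an algebraically closed field `κ` of characteristic `q` algebraic over `𝔽_q`, a smooth proper
model `𝒴 / W(κ)` of relative dimension `n` (`WittScheme.IsSmoothProperModel n 𝒴`), a pro-class `ξ̂`
on its `q`-adic tower, a (`k`-generic) complex point `s` and an embedding `ι : K(q, κ) →+* ℂ` with
`𝒴_K ⊗_ι ℂ ≅ X_s`, such that algebraization of `ξ̂|_{Y_κ}` implies algebraicity of `A|_{X_s}`. This file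
proves the MODEL-SUPPLY half — every conjunct except the pro-class `ξ̂` and the final implication —
for EVERY complex point `s` (so the lead may take `s` generic):

* `padicModelSupply` — for a smooth projective family `(baseChangeHom σ).map f₀` of relative dimension
  `n`, every complex point `s` of the base and every `N`, there are a prime `q ≥ N`,
  `κ = 𝔽̄_q` with all the instances STUB S quantifies over (`Field`, `CharP`, `PerfectRing`,
  `IsAlgClosed`, `Algebra (ZMod q)`, `Algebra.IsAlgebraic (ZMod q)`), a `W(κ)`-scheme `𝒴` with
  `WittScheme.IsSmoothProperModel n 𝒴`, and `ι : K(q, κ) →+* ℂ` with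
  `Nonempty ((baseChangeHom ι).obj (WittScheme.genericFibre 𝒴) ≅ fiberOver ((baseChangeHom σ).map f₀) s)`
  — binders verbatim as in `ArithmeticDiscSupply`;
* `padicModelSupply_of_isSmoothProjective` — the same for any smooth projective complex variety;
* `padicModelSupply_projective[_of_isSmoothProjective]` — the same with, moreover,
  `Crystalline.IsProjectiveOverRing 𝒴` and `n + 6 < q` (the hypotheses of the vendored
  Bloch–Esnault–Kerz lifting criterion `Crystalline.BlochEsnaultKerzLifting`, Thm. 1.3).

The mathematics is Literature: spreading out over a finitely generated `ℤ`-algebra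
(`Limits.exists_smooth_projective_model_finiteType_int`, EGA IV₃ §8), Cassels' embedding theorem in
Witt-vector form with a compatible complex embedding
(`CompleteLocalRings.exists_injective_ringHom_wittVector_comp_eq`, Cassels 1976), Zariski
connectedness over `W(κ)` (Stacks 0AY8), assembled in
`Motives.exists_isSmoothProperModel_wittVector` (Maulik–Poonen 2012 §4 pattern).
-/

noncomputable section

-- every declaration of this problem lives in `Summit.HodgeConjecture.HodgeConjecture.…` (summit = sub-problem)
set_option linter.dupNamespace false

open CategoryTheory AlgebraicGeometry
open Literature.AlgebraicGeometry.Motives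
open scoped Isocrystal

namespace Summit.HodgeConjecture.HodgeConjecture.Theorems

/-- **Model supply for one smooth projective complex variety** (the `(q, κ, 𝒴, ι)`-part of STUB S of
line `padic-disc-transport`, binders as in `PadicDiscTransport.ArithmeticDiscSupply`): for `X` smooth
projective of dimension `n` over `ℂ` and a bound `N` there are a prime `q ≥ N`, an algebraically closed
field `κ` of characteristic `q` algebraic over `ZMod q` (namely `𝔽̄_q`), a smooth proper model
`𝒴 / W(κ)` of relative dimension `n` (`WittScheme.IsSmoothProperModel n 𝒴`) and an embedding
`ι : K(q, κ) →+* ℂ` with `𝒴_K ⊗_ι ℂ ≅ X` (`Motives.exists_isSmoothProperModel_wittVector`). -/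
theorem padicModelSupply_of_isSmoothProjective {n : ℕ} {X : SchemeOver ℂ}
    (hX : IsSmoothProjective n X) (N : ℕ) :
    ∃ (q : ℕ) (_ : Fact q.Prime) (κ : Type) (_ : Field κ) (_ : CharP κ q) (_ : PerfectRing κ q)
      (_ : IsAlgClosed κ) (_ : Algebra (ZMod q) κ) (_ : Algebra.IsAlgebraic (ZMod q) κ)
      (𝒴 : SchemeOver (WittVector q κ)) (ι : K(q, κ) →+* ℂ),
      N ≤ q ∧ WittScheme.IsSmoothProperModel n 𝒴 ∧
      Nonempty ((baseChangeHom ι).obj (WittScheme.genericFibre 𝒴) ≅ X) := by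
  obtain ⟨q, hq, 𝒴, ι, hNq, h𝒴, hiso⟩ := exists_isSmoothProperModel_wittVector hX N
  haveI := hq
  haveI : PerfectRing (AlgebraicClosure (ZMod q)) q := PerfectField.toPerfectRing q
  exact ⟨q, hq, AlgebraicClosure (ZMod q), inferInstance, inferInstance, inferInstance, inferInstance,
    inferInstance, inferInstance, 𝒴, ι, hNq, h𝒴, hiso⟩


/-- **Model supply, PROJECTIVE form, with the Bloch–Esnault–Kerz bound**: as
`padicModelSupply_of_isSmoothProjective`, and moreover `𝒴` is projective over `W(κ)`
(`Crystalline.IsProjectiveOverRing 𝒴`, the hypothesis "`X/W` smooth projective" of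
`Crystalline.BlochEsnaultKerzLifting`) and `n + 6 < q` (the bound of BEK 2014, Thm. 1.3), so that the
lead can feed `𝒴` to the vendored lifting criterion. -/
theorem padicModelSupply_projective_of_isSmoothProjective {n : ℕ} {X : SchemeOver ℂ}
    (hX : IsSmoothProjective n X) (N : ℕ) :
    ∃ (q : ℕ) (_ : Fact q.Prime) (κ : Type) (_ : Field κ) (_ : CharP κ q) (_ : PerfectRing κ q)
      (_ : IsAlgClosed κ) (_ : Algebra (ZMod q) κ) (_ : Algebra.IsAlgebraic (ZMod q) κ)
      (𝒴 : SchemeOver (WittVector q κ)) (ι : K(q, κ) →+* ℂ),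
      N ≤ q ∧ n + 6 < q ∧ WittScheme.IsSmoothProperModel n 𝒴 ∧
      Literature.AlgebraicGeometry.Crystalline.IsProjectiveOverRing 𝒴 ∧
      Nonempty ((baseChangeHom ι).obj (WittScheme.genericFibre 𝒴) ≅ X) := by
  obtain ⟨q, hq, 𝒴, ι, M, embW, hembW, hembWg, hNq, h𝒴, hiso⟩ :=
    exists_isSmoothProperModel_wittVector_proj hX (max N (n + 7))
  haveI := hq
  haveI : PerfectRing (AlgebraicClosure (ZMod q)) q := PerfectField.toPerfectRing q
  have hproj : Literature.AlgebraicGeometry.Crystalline.IsProjectiveOverRing 𝒴 :=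
    ⟨M, Over.homMk embW hembWg, hembW⟩
  exact ⟨q, hq, AlgebraicClosure (ZMod q), inferInstance, inferInstance, inferInstance, inferInstance,
    inferInstance, inferInstance, 𝒴, ι, (le_max_left _ _).trans hNq,
    by have := (le_max_right N (n + 7)).trans hNq; omega, h𝒴, hproj, hiso⟩

/-- **MODEL SUPPLY for STUB S (`ArithmeticDiscSupply`) of line `padic-disc-transport`**: for a smooth
projective family `(baseChangeHom σ).map f₀` of relative dimension `n` (data descended to a field `k`
along `σ : k →+* ℂ`, as in the skeleton), EVERY complex point `s` of the base and every bound `N`,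
there are a prime `q ≥ N`, `κ = 𝔽̄_q` (algebraically closed, perfect, algebraic over `ZMod q`), a
`W(κ)`-scheme `𝒴` with `WittScheme.IsSmoothProperModel n 𝒴` and `ι : K(q, κ) →+* ℂ` with
`(baseChangeHom ι).obj (WittScheme.genericFibre 𝒴) ≅ fiberOver ((baseChangeHom σ).map f₀) s` — all
conjuncts of `ArithmeticDiscSupply` except the pro-class `ξ̂` and the algebraization implication, with
its binders verbatim (the fibre is smooth projective by `IsSmoothProjectiveFamily.isSmoothProjective`). -/
theorem padicModelSupply (N : ℕ) (k : Type) [Field k] (σ : k →+* ℂ) {n : ℕ}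
    {𝒳₀ S₀ : SchemeOver k} (f₀ : 𝒳₀ ⟶ S₀)
    (hf : IsSmoothProjectiveFamily ((baseChangeHom σ).map f₀) n)
    (s : ComplexPoints ((baseChangeHom σ).obj S₀)) :
    ∃ (q : ℕ) (_ : Fact q.Prime) (κ : Type) (_ : Field κ) (_ : CharP κ q) (_ : PerfectRing κ q)
      (_ : IsAlgClosed κ) (_ : Algebra (ZMod q) κ) (_ : Algebra.IsAlgebraic (ZMod q) κ)
      (𝒴 : SchemeOver (WittVector q κ)) (ι : K(q, κ) →+* ℂ),
      N ≤ q ∧ WittScheme.IsSmoothProperModel n 𝒴 ∧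
      Nonempty ((baseChangeHom ι).obj (WittScheme.genericFibre 𝒴) ≅
        fiberOver ((baseChangeHom σ).map f₀) s) :=
  padicModelSupply_of_isSmoothProjective (hf.isSmoothProjective s) N


/-- **MODEL SUPPLY for STUB S, projective form with the BEK bound** (`padicModelSupply` plus
`Crystalline.IsProjectiveOverRing 𝒴` and `n + 6 < q`). -/
theorem padicModelSupply_projective (N : ℕ) (k : Type) [Field k] (σ : k →+* ℂ) {n : ℕ}
    {𝒳₀ S₀ : SchemeOver k} (f₀ : 𝒳₀ ⟶ S₀)
    (hf : IsSmoothProjectiveFamily ((baseChangeHom σ).map f₀) n)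
    (s : ComplexPoints ((baseChangeHom σ).obj S₀)) :
    ∃ (q : ℕ) (_ : Fact q.Prime) (κ : Type) (_ : Field κ) (_ : CharP κ q) (_ : PerfectRing κ q)
      (_ : IsAlgClosed κ) (_ : Algebra (ZMod q) κ) (_ : Algebra.IsAlgebraic (ZMod q) κ)
      (𝒴 : SchemeOver (WittVector q κ)) (ι : K(q, κ) →+* ℂ),
      N ≤ q ∧ n + 6 < q ∧ WittScheme.IsSmoothProperModel n 𝒴 ∧
      Literature.AlgebraicGeometry.Crystalline.IsProjectiveOverRing 𝒴 ∧
      Nonempty ((baseChangeHom ι).obj (WittScheme.genericFibre 𝒴) ≅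
        fiberOver ((baseChangeHom σ).map f₀) s) :=
  padicModelSupply_projective_of_isSmoothProjective (hf.isSmoothProjective s) N

end Summit.HodgeConjecture.HodgeConjecture.Theorems

end
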